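import Mathlib.Data.Matrix.Basis
import Mathlib.Data.Matrix.Mul
import Mathlib.LinearAlgebra.Pi
import Mathlib.Algebra.Group.Subgroup.Finite
import Literature.NumberTheory.GaloisRepresentations.LocalGlobalCohomologyDualityProofs
import HarnessLib

/-!
# X11b at `p = 3` (team N8/O2), LINE-K sub-target E-K8 · IMG3-GEN (2/3): Morita — a submodule of
# `X^n` stable under a spanning set of matrices is `Y^n`; duality — a subgroup of `Hom(C, ℤ/n)`
# detecting every `c ≠ 0` is everything (cell `b2b-bsdres`, team `x11b3`, seat p2)

HONEST FRAMING (verbatim, cell `b2b-bsdres`, run/shared/lean/b2b/bsd-rank1-residual/): the goal of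
the cell is to DELETE the COMBINATION-SHAPED residual classes for ALL analytic-rank `≤ 1` curves
over `ℚ` — "full BSD formula for every rank `≤ 1` curve in class `C`" assembled STRICTLY from
published theorems — so that the rank-`≤ 1` remainder becomes exactly the CONSTRUCTION-SHAPED
classes, which are TYPED (missing-input Props), NOT attempted; this is not "finishing BSD".
Research route (team N8/O2: STEP L at `3 ‖ N`, LINE K); PURE ALGEBRA; nothing booked; no label
touched; X11b@3 stays OPEN (RESIDUAL-MAP §I O2). THEOREMS ONLY; no definition; no named fact;
no `sorry`.

## Why (LINE-K.md ⟦r2 05:57Z⟧ block 3, step U2 = McCallum 1991 §3 (2), surjectivity half;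
## sub-target E-K8 · IMG3-GEN, OWNERS.md claim ⟦x11b3-p2 GEN 2, 06:02Z⟧)

McCallum's structure theorem for `Ш(E/K)[p^∞]` (tree fact
`Literature/…/KolyvaginShaStructure.lean`, consumer `Three/McCallumCertificate.lean`) is printed
under "`Gal(ℚ(E_p)/ℚ) = GL₂(ℤ/p)`" and uses, at level `p^M`, that for `L = K(E_{p^M})` and every
finite `C ≤ H¹(K, E_{p^M})` one has `Gal(L_C/L) ≅ Hom(C, E_{p^M})` equivariantly. Besides
`H¹(L/K, E_{p^M}) = 0` (U1 — Sah, in the tree: `Three/ImageSah`, `Three/TorsionNegOneLift`,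
`Three/GaloisImageNegOne`) the proof needs that the image `Γ_M = ρ_{E,p^M}(G_K) ≤ GL₂(ℤ/p^M)`
GENERATES the matrix ring `M₂(ℤ/p^M)`, so that `Γ_M`-stable subgroups of
`Hom(C, E_{p^M}) ≅ Hom(C, ℤ/p^M)^{⊕ 2}` are `M₂`-submodules, hence of the form `Y ⊕ Y` (Morita),
and then `Y = Hom(C, ℤ/p^M)` by duality of finite groups. At `p = 3` the usual shortcut
"`p ∤ #Γ`" is dead (`3 ∣ #GL₂(𝔽₃) = 48`); none is needed: everything follows from the surjectivity
of the MOD-`p` representation ALONE (no `3`-adic tower hypothesis), for every prime `p` and every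
level `p^{k+1}`. The three files of E-K8: `Three/ImageSpan` (the span), `Three/MoritaDuality`
(Morita + duality), `Three/ImageGenerates` (assembly).

## What is proved here (elementary)

* `Morita.mem_iff_forall_single_mem` — an additive submonoid `W` of `n → X` stable under every
  matrix unit `v ↦ single i (v j)` satisfies `v ∈ W ↔ ∀ j, single i₀ (v j) ∈ W`; submodule form
  `Morita.eq_pi` (`W = Π_j Y`, `Y = single i₀ ⁻¹ W`). Lang, *Algebra* XVII §1.
* `Morita.single_apply_mem_of_span_eq_top` — stability of a submodule under a SPANNING set of
  matrices acting by `(A·v)_i = Σ_j A_{ij} • v_j` gives stability under every matrix unit (the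
  matrices preserving `W` form a submodule of `M_n(R)`); `Morita.sum_smul_eq_mulVec` — for `X = R`
  this action is `Matrix.mulVec`.
* `Duality.eq_top_of_forall_exists_apply_ne_zero` — for a finite abelian group `C` killed by
  `n ≠ 0`, an additive subgroup `Y ≤ Hom(C, ℤ/n)` such that every `c ≠ 0` has some `f ∈ Y` with
  `f c ≠ 0` is all of `Hom(C, ℤ/n)` (counting: `C ↪ Hom(Y, ℤ/n)`, `#Hom(B, ℤ/n) = #B` by the tree's
  `Literature.NumberTheory.GaloisRepresentations.Nat.card_addMonoidHom_zmod`, Milne ADT I (0.19)).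
  This is the last algebraic step of McCallum §3 (2): with `W = Y ⊕ Y` and `Y ≠ Hom(C, ℤ/p^M)` some
  `c ≠ 0` would restrict to `0` over `L_C`, contradicting `H¹(L/K, E_{p^M}) = 0` (U1).

What this file is NOT: no Galois cohomology, no elliptic curve, no claim about any class;
nothing booked. Companions: `Three/ImageSpan.lean` (1/3), `Three/ImageGenerates.lean` (3/3).

References: W. G. McCallum, *Kolyvagin's work on Shafarevich–Tate groups*, in L-functions and
Arithmetic (Durham 1989), LMS LNS 153 (1991), §3 [McCallum1991]; J.-P. Serre, *Propriétés
galoisiennes des points d'ordre fini des courbes elliptiques*, Invent. Math. 15 (1972) §IV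
[Serre1972]; S. Lang, *Algebra*, XVII §1 (modules over matrix rings) [Lang2002];
J. S. Milne, *Arithmetic Duality Theorems*, I §0 (0.19) [MilneADT2006]; team files
`cells/x11b3/LINE-K.md` block 3 (U2, E-K8), `cells/x11b3/PLAN.md` §2.
-/

namespace Summit.BirchSwinnertonDyer.Rank1Residual.X11b.Three

open Matrix

/-! ## §3 Morita: submodules of `X^n` stable under the matrix units -/

namespace Morita

section Monoid

variable {X : Type*} [AddCommMonoid X] {n : Type*} [Fintype n] [DecidableEq n]

/-- **Morita, membership form.** An additive submonoid `W` of `n → X` stable under every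
"matrix unit" `v ↦ single i (v j)` satisfies `v ∈ W ↔ ∀ j, single i₀ (v j) ∈ W` for any fixed
index `i₀` (`v = Σ_j single j (v j)` and `single j (v j) = single j ((single i₀ (v j)) i₀)`); i.e.
`W = Y^n` with `Y = {x | single i₀ x ∈ W}`. Lang, *Algebra* XVII §1. [folklore] -/
theorem mem_iff_forall_single_mem {W : AddSubmonoid (n → X)}
    (hW : ∀ (i j : n), ∀ v ∈ W, (Pi.single i (v j) : n → X) ∈ W) (i₀ : n) (v : n → X) :
    v ∈ W ↔ ∀ j, (Pi.single i₀ (v j) : n → X) ∈ W := by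
  refine ⟨fun hv j => hW i₀ j v hv, fun h => ?_⟩
  rw [← Finset.univ_sum_single v]
  refine sum_mem fun j _ => ?_
  have hj := hW j i₀ _ (h j)
  rwa [Pi.single_eq_same] at hj

end Monoid

section Module

variable {R : Type*} [Semiring R] {X : Type*} [AddCommMonoid X] [Module R X]
  {n : Type*} [Fintype n] [DecidableEq n]

/-- **Morita, submodule form**: `W = Π_{j} Y` with `Y = single i₀ ⁻¹ W`. [folklore] -/
theorem eq_pi (W : Submodule R (n → X))
    (hW : ∀ (i j : n), ∀ v ∈ W, (Pi.single i (v j) : n → X) ∈ W) (i₀ : n) :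
    W = Submodule.pi Set.univ (fun _ : n => W.comap (LinearMap.single R (fun _ : n => X) i₀)) := by
  ext v
  rw [Submodule.mem_pi]
  simp only [Set.mem_univ, forall_const, Submodule.mem_comap, LinearMap.coe_single]
  exact mem_iff_forall_single_mem (W := W.toAddSubmonoid) hW i₀ v

/-- **From a spanning set of matrices to the matrix units.** If a submodule `W ≤ (n → X)` is
stable under every matrix `A` of a set `S` acting by `(A·v)_i = Σ_j A_{ij} • v_j`, and `S` spans
`M_n(R)`, then `W` is stable under every matrix (the set of matrices preserving `W` is a submodule
of `M_n(R)`), in particular under the matrix units: `single i (v j) ∈ W` (`E_{ij}·v`). [folklore] -/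
theorem single_apply_mem_of_span_eq_top {S : Set (Matrix n n R)} (hS : Submodule.span R S = ⊤)
    (W : Submodule R (n → X))
    (hW : ∀ A ∈ S, ∀ v ∈ W, (fun i => ∑ j, A i j • v j) ∈ W)
    (i j : n) (v : n → X) (hv : v ∈ W) : (Pi.single i (v j) : n → X) ∈ W := by
  -- matrices preserving `v ↦ W` form a submodule `T` of `M_n(R)`
  let T : Submodule R (Matrix n n R) :=
    { carrier := {A | (fun i => ∑ j, A i j • v j) ∈ W}
      add_mem' := by
        intro A B hA hB
        change (fun i => ∑ j, (A + B) i j • v j) ∈ W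
        have e : (fun i => ∑ j, (A + B) i j • v j)
            = (fun i => ∑ j, A i j • v j) + (fun i => ∑ j, B i j • v j) := by
          ext i
          simp only [Matrix.add_apply, add_smul, Finset.sum_add_distrib, Pi.add_apply]
        rw [e]
        exact W.add_mem hA hB
      zero_mem' := by
        change (fun i => ∑ j, (0 : Matrix n n R) i j • v j) ∈ W
        simp only [Matrix.zero_apply, zero_smul, Finset.sum_const_zero]
        exact W.zero_mem
      smul_mem' := by
        intro c A hA
        change (fun i => ∑ j, (c • A) i j • v j) ∈ W
        have e : (fun i => ∑ j, (c • A) i j • v j) = c • (fun i => ∑ j, A i j • v j) := by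
          ext i
          simp only [Matrix.smul_apply, smul_eq_mul, mul_smul, Pi.smul_apply, Finset.smul_sum]
        rw [e]
        exact W.smul_mem c hA }
  have hT : Submodule.span R S ≤ T := Submodule.span_le.mpr fun A hA => hW A hA v hv
  rw [hS, top_le_iff] at hT
  have hE : Matrix.single i j (1 : R) ∈ T := by rw [hT]; exact Submodule.mem_top
  change (fun i' => ∑ j', Matrix.single i j (1 : R) i' j' • v j') ∈ W at hE
  convert hE using 1
  ext i'
  by_cases hi : i = i'
  · subst hi
    simp [Matrix.single_apply, ite_smul, Finset.sum_ite_eq]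
  · rw [Pi.single_eq_of_ne (Ne.symm hi)]
    simp [hi]

/-- For `X = R` the action `(A·v)_i = Σ_j A_{ij} • v_j` is `Matrix.mulVec`. [folklore] -/
theorem sum_smul_eq_mulVec {R : Type*} [CommSemiring R] {n : Type*} [Fintype n]
    (A : Matrix n n R) (v : n → R) : (fun i => ∑ j, A i j • v j) = A *ᵥ v := by
  ext i
  simp [Matrix.mulVec, dotProduct, smul_eq_mul]

end Module

end Morita

/-! ## §5 Duality for finite groups with values in `ℤ/n` -/

namespace Duality

/-- **A subgroup of `Hom(C, ℤ/n)` without common kernel is everything.** For a finite abelian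
group `C` killed by `n ≠ 0` and an additive subgroup `Y ≤ Hom(C, ℤ/n)`: if every `c ≠ 0` is
detected by some `f ∈ Y` (`f c ≠ 0`), then `Y = Hom(C, ℤ/n)`. Counting: `c ↦ (f ↦ f c)` embeds
`C` into `Hom(Y, ℤ/n)`, so `#C ≤ #Hom(Y, ℤ/n) = #Y ≤ #Hom(C, ℤ/n) = #C` (tree
`Nat.card_addMonoidHom_zmod`, Milne ADT I (0.19)). This is the last algebraic step of McCallum
§3 (2): with `W = Y ⊕ Y` (§4) and `Y ≠ Hom(C, ℤ/p^M)` one would get `c ≠ 0` restricting to `0`,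
contradicting `H¹(L/K, E_{p^M}) = 0` (U1). [folklore] -/
theorem eq_top_of_forall_exists_apply_ne_zero {C : Type*} [AddCommGroup C] [Finite C] {n : ℕ}
    [NeZero n] (hC : ∀ c : C, n • c = 0) (Y : AddSubgroup (C →+ ZMod n))
    (hY : ∀ c : C, c ≠ 0 → ∃ f ∈ Y, f c ≠ 0) : Y = ⊤ := by
  haveI : Finite (C →+ ZMod n) :=
    Literature.NumberTheory.GaloisRepresentations.finite_addMonoidHom_zmod C n
  haveI : Finite (Y →+ ZMod n) :=
    Literature.NumberTheory.GaloisRepresentations.finite_addMonoidHom_zmod Y n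
  -- evaluation `C → Hom(Y, ℤ/n)` is injective
  let ev : C →+ (Y →+ ZMod n) :=
    { toFun := fun c =>
        { toFun := fun f => (f : C →+ ZMod n) c
          map_zero' := rfl
          map_add' := fun f g => rfl }
      map_zero' := by ext f; exact map_zero (f : C →+ ZMod n)
      map_add' := fun c c' => by ext f; exact map_add (f : C →+ ZMod n) c c' }
  have hev : Function.Injective ev := by
    rw [injective_iff_map_eq_zero]
    intro c hc
    by_contra hc0
    obtain ⟨f, hf, hfc⟩ := hY c hc0
    exact hfc (DFunLike.congr_fun hc ⟨f, hf⟩)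
  have hYn : ∀ f : Y, n • f = 0 := by
    intro f
    apply Subtype.ext
    ext c
    change n • ((f : C →+ ZMod n) c) = 0
    rw [nsmul_eq_mul, ZMod.natCast_self, zero_mul]
  have h1 : Nat.card C ≤ Nat.card Y :=
    (Nat.card_le_card_of_injective ev hev).trans_eq
      (Literature.NumberTheory.GaloisRepresentations.Nat.card_addMonoidHom_zmod hYn)
  have h2 : Nat.card (C →+ ZMod n) = Nat.card C :=
    Literature.NumberTheory.GaloisRepresentations.Nat.card_addMonoidHom_zmod hC
  apply AddSubgroup.eq_top_of_card_eq
  exact le_antisymm (AddSubgroup.card_le_card_addGroup Y) (h2 ▸ h1)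

end Duality

end Summit.BirchSwinnertonDyer.Rank1Residual.X11b.Three
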